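import Summits.SmoothPoincare4.SmoothPoincare4.Theorems.CongruenceShadowsShadowApproximationStubLayerStepZeroTwoRealisersA
import Summits.SmoothPoincare4.SmoothPoincare4.Theorems.CongruenceShadowsShadowApproximationStubLayerStepZeroTwoRealisersB
import HarnessLib

/-!
# Helper X (the six realisers packaged; data add on `𝒥₃`; transfer one level up) for stub `stub_layerStepZeroTwo` of
line `nilpotent-genus-class`, crux `CongruenceShadows.ShadowApproximation` (item stmt-SmoothPoincare4-14595)

Genus `3`, notation of the siblings.
* `exists_realisers3` — THE SIX REALISERS PACKAGED: six Goeritz elements `V_k ∈ Stab N₀ ∩ Stab N₁` of `S₃` lying in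
  `𝒥₃` (`V_k(s)s⁻¹ ∈ γ₄`) whose degree-three data `θ₃(π(V_k(X_j)X_j⁻¹)) ∈ L₄` at the cut letters `X_j = b₀, a₁, a₂` of
  `N₂` are the rows of the literal `6 × 3 × 18` coordinate table of the registered Lie side
  `helper_layerZeroTwoLieRealise` (the realisers `real₀, …, real₅` of `…RealisersA/B`: commutators in `Aut S₃` of IA
  Goeritz elements with conjugated handle twists);
* `datum_list_prod_zpow3` — data add on `𝒥₃` (level-three Johnson calculus);
* `mem_commutator_sup_of_map_mem₄` — transfer one level up the lower central series.
No definitions, no notations.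
-/

set_option linter.dupNamespace false

noncomputable section

open Subgroup Literature.Topology.FourManifolds Literature.Algebra.Lie Multiplicative
open Summit.SmoothPoincare4.SmoothPoincare4.Theorems.NilpotentShadowsStandard.SaturatedTorsorDescent
open scoped commutatorElement

namespace Summit.SmoothPoincare4.SmoothPoincare4.Theorems.ShadowApproximation.NilpotentGenusClass

namespace LayerZeroTwo

open LayerZeroOne

/-! ## Generalities one level up -/

/-- Transfer one level up: an element of `γ₄` whose image under a surjection `π` onto a free group lies in
`γ₅` lies in `[ker π, G] γ₅`, provided `ker π` has no hidden depth. [folklore] -/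
theorem mem_commutator_sup_of_map_mem₄ {G M : Type*} [Group G] [Group M] (π : G →* M)
    (hπ : Function.Surjective π)
    (hker : π.ker ⊓ (⊤ : Subgroup G).lowerCentralSeries 1 ≤ ⁅π.ker, (⊤ : Subgroup G)⁆)
    {w : G} (hw : w ∈ (⊤ : Subgroup G).lowerCentralSeries 3)
    (h : π w ∈ (⊤ : Subgroup M).lowerCentralSeries 4) :
    w ∈ ⁅π.ker, (⊤ : Subgroup G)⁆ ⊔ (⊤ : Subgroup G).lowerCentralSeries 4 := by
  rw [← map_lcs_eq_of_surjective π hπ 4] at h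
  obtain ⟨z, hz, hzw⟩ := h
  have h1 : w * z⁻¹ ∈ π.ker := by
    rw [MonoidHom.mem_ker, map_mul, map_inv, hzw, mul_inv_cancel]
  have h2 : w * z⁻¹ ∈ π.ker ⊓ (⊤ : Subgroup G).lowerCentralSeries 1 :=
    mem_inf.2 ⟨h1, mul_mem (lcs_antitone (by decide) hw) (inv_mem (lcs_antitone (by decide) hz))⟩
  have e : w = (w * z⁻¹) * z := by rw [inv_mul_cancel_right]
  rw [e]
  exact mul_mem (mem_sup_left (hker h2)) (mem_sup_right hz)

section Symbols

variable (θ : ℕ → FreeGroup (Fin 3) → FreeLieAlgebra ℤ (Fin 3))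
  (hadd : ∀ k, ∀ x ∈ (⊤ : Subgroup (FreeGroup (Fin 3))).lowerCentralSeries k,
    ∀ y ∈ (⊤ : Subgroup (FreeGroup (Fin 3))).lowerCentralSeries k, θ k (x * y) = θ k x + θ k y)
  (hker : ∀ k, ∀ x ∈ (⊤ : Subgroup (FreeGroup (Fin 3))).lowerCentralSeries k,
    θ k x = 0 ↔ x ∈ (⊤ : Subgroup (FreeGroup (Fin 3))).lowerCentralSeries (k + 1))
  (hof : ∀ i : Fin 3, θ 0 (FreeGroup.of i) = FreeLieAlgebra.of ℤ i)
  (hbr : ∀ j k, ∀ x ∈ (⊤ : Subgroup (FreeGroup (Fin 3))).lowerCentralSeries j,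
    ∀ y ∈ (⊤ : Subgroup (FreeGroup (Fin 3))).lowerCentralSeries k, θ (j + k + 1) ⁅x, y⁆ = ⁅θ j x, θ k y⁆)
  (π : SurfaceGroup 3 →* FreeGroup (Fin 3))

include hadd hker in
/-- **Data add on `𝒥₃`**: the product `y = ∏ Ψᵢ ^ nᵢ` (in `Aut S₃`) of elements of `𝒥₃` lies in `𝒥₃` and
`θ₃(π(y(s)s⁻¹)) = ∑ nᵢ θ₃(π(Ψᵢ(s)s⁻¹))`. [folklore] -/
theorem datum_list_prod_zpow3 {ι : Type*} (l : List ι) (Ψ : ι → SurfaceGroup 3 ≃* SurfaceGroup 3) (n : ι → ℤ)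
    (hΨ : ∀ i, ∀ s, Ψ i s * s⁻¹ ∈ (⊤ : Subgroup (SurfaceGroup 3)).lowerCentralSeries 3) (s : SurfaceGroup 3) :
    (∀ s, (l.map fun i => ((Ψ i : MulAut (SurfaceGroup 3)) ^ n i : MulAut (SurfaceGroup 3))).prod s * s⁻¹ ∈
      (⊤ : Subgroup (SurfaceGroup 3)).lowerCentralSeries 3) ∧
    θ 3 (π ((l.map fun i => ((Ψ i : MulAut (SurfaceGroup 3)) ^ n i : MulAut (SurfaceGroup 3))).prod s * s⁻¹)) =
      (l.map fun i => n i • θ 3 (π (Ψ i s * s⁻¹))).sum := by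
  obtain ⟨h1, h2⟩ := jk_list_prod_zpow (k := 3) (by norm_num) l Ψ n hΨ
  refine ⟨h1, ?_⟩
  have hmem : ∀ l' : List ι, (l'.map fun i => (Ψ i s * s⁻¹) ^ n i).prod ∈
      (⊤ : Subgroup (SurfaceGroup 3)).lowerCentralSeries 3 := fun l' =>
    list_prod_mem fun x hx => by
      obtain ⟨i, -, rfl⟩ := List.mem_map.1 hx
      exact zpow_mem (hΨ i s) _
  have h3 : (((l.map fun i => ((Ψ i : MulAut (SurfaceGroup 3)) ^ n i : MulAut (SurfaceGroup 3))).prod s * s⁻¹ :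
      SurfaceGroup 3) : SurfaceGroup 3 ⧸ (⊤ : Subgroup (SurfaceGroup 3)).lowerCentralSeries 4) =
      (((l.map fun i => (Ψ i s * s⁻¹) ^ n i).prod : SurfaceGroup 3) : SurfaceGroup 3 ⧸ _) := by
    rw [h2 s, ← QuotientGroup.mk'_apply, map_list_prod, List.map_map]
    refine congrArg List.prod (List.map_congr_left fun i _ => ?_)
    rw [Function.comp_apply, map_zpow, QuotientGroup.mk'_apply]
  have key : ∀ l' : List ι, θ 3 (π ((l'.map fun i => (Ψ i s * s⁻¹) ^ n i).prod)) =
      (l'.map fun i => n i • θ 3 (π (Ψ i s * s⁻¹))).sum := by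
    intro l'
    induction l' with
    | nil => simp only [List.map_nil, List.prod_nil, List.sum_nil, map_one]; exact theta_one θ hadd 3
    | cons i l' ih =>
      rw [List.map_cons, List.prod_cons, List.map_cons, List.sum_cons, map_mul,
        hadd 3 _ (FreeGroupGrLie.map_mem_lcs π (zpow_mem (hΨ i s) _)) _ (FreeGroupGrLie.map_mem_lcs π (hmem l')), ih,
        map_zpow, theta_zpow θ hadd 3 (FreeGroupGrLie.map_mem_lcs π (hΨ i s))]
  rw [theta_pi_congr θ hadd hker π 3 (hmem l) h3, key]

variable (hπof : ∀ (h : Fin 3) (b : Bool), π (PresentedGroup.of (h, b)) = if b = (![true, false, false] : Fin 3 → Bool) h then 1 else FreeGroup.of h)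

include hadd hker hof hbr hπof in
/-- **The six realisers in degree three and their data.** There are six Goeritz elements `V_k ∈ Stab N₀ ∩ Stab N₁` of
`S₃` lying in `𝒥₃` whose degree-three data `θ₃(π(V_k(X_j)X_j⁻¹)) ∈ L₄` at the cut letters `b₀, a₁, a₂` of `N₂` are
given by the literal `6 × 3 × 18` coordinate table of the Lie side in the eighteen basic brackets (the realisers
`real₀, …, real₅` of the siblings `…RealisersA/B`). [folklore] -/
theorem exists_realisers3 : ∃ V : Fin 6 → SurfaceGroup 3 ≃* SurfaceGroup 3, ∀ k : Fin 6,
    (s4Kernels 0).map (V k).toMonoidHom = s4Kernels 0 ∧ (s4Kernels 1).map (V k).toMonoidHom = s4Kernels 1 ∧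
    (∀ s, V k s * s⁻¹ ∈ (⊤ : Subgroup (SurfaceGroup 3)).lowerCentralSeries 3) ∧
    ∀ j : Fin 3, θ 3 (π (V k (PresentedGroup.of (j, (![true, false, false] : Fin 3 → Bool) j)) *
        (PresentedGroup.of (j, (![true, false, false] : Fin 3 → Bool) j) : SurfaceGroup 3)⁻¹)) =
      ∑ l, (![![![0, 0, 0, 0, 0, 0, 0, 1, 0, 0, 0, 0, 0, 0, 0, -2, 0, 0], ![0, 0, 0, 0, 0, 0, -1, 0, 0, 0, 0, 0, 0, 0, 0, 0, 0, 0], ![0, 0, -1, 0, 0, 0, 0, 0, 1, 0, 0, 0, 0, 0, 0, 0, 0, 0]], ![![0, 0, 0, 0, 0, 0, 0, 0, 0, 0, 0, -1, 0, 0, 0, 0, 0, 0], ![0, 0, 0, 0, -3, 0, 0, 0, 0, 2, 0, 0, -1, 0, 0, 0, 0, 0], ![0, 0, 0, 0, 0, 0, 0, 0, 0, 0, 1, 0, 0, 0, 0, 0, 0, 0]], ![![0, 0, 0, 0, 0, 0, 0, 1, 0, 0, 0, 0, 0, 0, -1, -2, 0, 0], ![0, 0, 0, 0, 0, 0, -1,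 -2, 0, 0, 0, 0, 0, -1, 0, 2, 0, 0], ![0, 0, -1, 0, -1, 0, 0, 0, 1, 1, 0, 0, 1, 0, 0, 0, 0, 0]], ![![0, 0, 0, 0, 1, 0, 0, 0, 0, -2, 0, 0, 0, 0, 0, 0, 0, 0], ![0, 0, -2, 0, 0, -2, 0, 0, 1, 0, 0, 0, 0, 0, 0, 0, 0, 0], ![0, 0, 0, 1, 0, 0, 0, 0, 0, 0, 0, 0, 0, 0, 0, 0, 0, 0]], ![![0, 0, 0, 0, 0, 0, 0, 0, 0, 0, 0, 0, 0, 0, 0, 0, 0, 1], ![0, 0, 0, 0, 0, 0, 0, 0, 0, 0, 0, 0, 0, 0, 0, 0, 1, 0], ![0, 0, 0, 0, 0, 0, 0, 2, 0, 0, 0, 0, 0, -1, 0, -1, 0, 0]], ![![0, 0, 2, 0, 0, 3, 0, 1, -3, 0, 0, 0, 0, 0, 0, -2, 0, 0], ![0, -1, 0, 0, 0, 0, -1, 0, 0, 0, 0, 0, 0, 0, 0, 0, 0, 0], ![1, 0, -1, 0, 0, 0, 0, 0, 1, 0, 0, 0, 0, 0, 0, 0, 0, 0]]] : Fin 6 →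 Fin 3 → Fin 18 → ℤ) k j l • (![⁅FreeLieAlgebra.of ℤ (0 : Fin 3), ⁅FreeLieAlgebra.of ℤ (0 : Fin 3), ⁅FreeLieAlgebra.of ℤ (0 : Fin 3), FreeLieAlgebra.of ℤ (1 : Fin 3)⁆⁆⁆, ⁅FreeLieAlgebra.of ℤ (0 : Fin 3), ⁅FreeLieAlgebra.of ℤ (0 : Fin 3), ⁅FreeLieAlgebra.of ℤ (0 : Fin 3), FreeLieAlgebra.of ℤ (2 : Fin 3)⁆⁆⁆, ⁅FreeLieAlgebra.of ℤ (0 : Fin 3), ⁅FreeLieAlgebra.of ℤ (0 : Fin 3), ⁅FreeLieAlgebra.of ℤ (1 : Fin 3), FreeLieAlgebra.of ℤ (2 : Fin 3)⁆⁆⁆, ⁅FreeLieAlgebra.of ℤ (0 : Fin 3), ⁅FreeLieAlgebra.of ℤ (1 : Fin 3), ⁅FreeLieAlgebra.of ℤ (0 : Fin 3), FreeLieAlgebra.of ℤ (1 : Fin 3)⁆⁆⁆, ⁅FreeLieAlgebra.of ℤ (0 : Fin 3), ⁅FreeLieAlgebra.of ℤ (1 : Fin 3), ⁅FreeLieAlgebra.of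 ℤ (1 : Fin 3), FreeLieAlgebra.of ℤ (2 : Fin 3)⁆⁆⁆, ⁅FreeLieAlgebra.of ℤ (0 : Fin 3), ⁅FreeLieAlgebra.of ℤ (2 : Fin 3), ⁅FreeLieAlgebra.of ℤ (0 : Fin 3), FreeLieAlgebra.of ℤ (1 : Fin 3)⁆⁆⁆, ⁅FreeLieAlgebra.of ℤ (0 : Fin 3), ⁅FreeLieAlgebra.of ℤ (2 : Fin 3), ⁅FreeLieAlgebra.of ℤ (0 : Fin 3), FreeLieAlgebra.of ℤ (2 : Fin 3)⁆⁆⁆, ⁅FreeLieAlgebra.of ℤ (0 : Fin 3), ⁅FreeLieAlgebra.of ℤ (2 : Fin 3), ⁅FreeLieAlgebra.of ℤ (1 : Fin 3), FreeLieAlgebra.of ℤ (2 : Fin 3)⁆⁆⁆, ⁅FreeLieAlgebra.of ℤ (1 : Fin 3), ⁅FreeLieAlgebra.of ℤ (0 : Fin 3), ⁅FreeLieAlgebra.of ℤ (0 : Fin 3), FreeLieAlgebra.of ℤ (2 : Fin 3)⁆⁆⁆, ⁅FreeLieAlgebra.of ℤ (1 : Fin 3), ⁅FreeLieAlgebra.of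 ℤ (0 : Fin 3), ⁅FreeLieAlgebra.of ℤ (1 : Fin 3), FreeLieAlgebra.of ℤ (2 : Fin 3)⁆⁆⁆, ⁅FreeLieAlgebra.of ℤ (1 : Fin 3), ⁅FreeLieAlgebra.of ℤ (1 : Fin 3), ⁅FreeLieAlgebra.of ℤ (0 : Fin 3), FreeLieAlgebra.of ℤ (1 : Fin 3)⁆⁆⁆, ⁅FreeLieAlgebra.of ℤ (1 : Fin 3), ⁅FreeLieAlgebra.of ℤ (1 : Fin 3), ⁅FreeLieAlgebra.of ℤ (1 : Fin 3), FreeLieAlgebra.of ℤ (2 : Fin 3)⁆⁆⁆, ⁅FreeLieAlgebra.of ℤ (1 : Fin 3), ⁅FreeLieAlgebra.of ℤ (2 : Fin 3), ⁅FreeLieAlgebra.of ℤ (0 : Fin 3), FreeLieAlgebra.of ℤ (1 : Fin 3)⁆⁆⁆, ⁅FreeLieAlgebra.of ℤ (1 : Fin 3), ⁅FreeLieAlgebra.of ℤ (2 : Fin 3), ⁅FreeLieAlgebra.of ℤ (0 : Fin 3), FreeLieAlgebra.of ℤ (2 : Fin 3)⁆⁆⁆, ⁅FreeLieAlgebra.of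 ℤ (1 : Fin 3), ⁅FreeLieAlgebra.of ℤ (2 : Fin 3), ⁅FreeLieAlgebra.of ℤ (1 : Fin 3), FreeLieAlgebra.of ℤ (2 : Fin 3)⁆⁆⁆, ⁅FreeLieAlgebra.of ℤ (2 : Fin 3), ⁅FreeLieAlgebra.of ℤ (0 : Fin 3), ⁅FreeLieAlgebra.of ℤ (1 : Fin 3), FreeLieAlgebra.of ℤ (2 : Fin 3)⁆⁆⁆, ⁅FreeLieAlgebra.of ℤ (2 : Fin 3), ⁅FreeLieAlgebra.of ℤ (2 : Fin 3), ⁅FreeLieAlgebra.of ℤ (0 : Fin 3), FreeLieAlgebra.of ℤ (2 : Fin 3)⁆⁆⁆, ⁅FreeLieAlgebra.of ℤ (2 : Fin 3), ⁅FreeLieAlgebra.of ℤ (2 : Fin 3), ⁅FreeLieAlgebra.of ℤ (1 : Fin 3), FreeLieAlgebra.of ℤ (2 : Fin 3)⁆⁆⁆] : Fin 18 → FreeLieAlgebra ℤ (Fin 3)) l := by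
  choose T hT0 hT1 hT2 hTh hTne using exists_twist
  obtain ⟨β, hβ0, hβ1, hβIA, hβa0, hβb0, hβa1, hβb1, hβa2, hβb2⟩ := exists_bp_goeritz
  obtain ⟨x4, hx40, hx41, hx4IA, hx4of⟩ := exists_x4
  obtain ⟨r00, r01, r02, r03, r04, r05⟩ := real0 θ hadd hker hof hbr π hπof β (T 2) hβIA hβa0 hβb0 hβa1 hβb1 hβa2 hβb2 hβ0 hβ1
    (hT2 2) (hTh 2) (hTne 2) (hT0 2) (hT1 2)
  obtain ⟨r10, r11, r12, r13, r14, r15⟩ := real1 θ hadd hker hof hbr π hπof β (T 1) hβIA hβa0 hβb0 hβa1 hβb1 hβa2 hβb2 hβ0 hβ1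
    (hT2 1) (hTh 1) (hTne 1) (hT0 1) (hT1 1)
  obtain ⟨r20, r21, r22, r23, r24, r25⟩ := real2 θ hadd hker hof hbr π hπof β (T 2) hβIA hβa0 hβb0 hβa1 hβb1 hβa2 hβb2 hβ0 hβ1
    (hT2 2) (hTh 2) (hTne 2) (hT0 2) (hT1 2)
  obtain ⟨r30, r31, r32, r33, r34, r35⟩ := real3 θ hadd hker hof hbr π hπof β (T 1) hβIA hβa0 hβb0 hβa1 hβb1 hβa2 hβb2 hβ0 hβ1
    (hT2 1) (hTh 1) (hTne 1) (hT0 1) (hT1 1)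
  obtain ⟨r40, r41, r42, r43, r44, r45⟩ := real4 θ hadd hker hof hbr π hπof x4 (T 1) hx40 hx41 hx4IA hx4of
    (hT2 1) (hTh 1) (hTne 1) (hT0 1) (hT1 1)
  obtain ⟨r50, r51, r52, r53, r54, r55⟩ := real5 θ hadd hker hof hbr π hπof β (T 2) hβIA hβa0 hβb0 hβa1 hβb1 hβa2 hβb2 hβ0 hβ1
    (hT2 2) (hTh 2) (hTne 2) (hT0 2) (hT1 2)
  refine ⟨![(⁅((MulEquiv.refl (SurfaceGroup 3)).symm.trans (β.trans (MulEquiv.refl (SurfaceGroup 3))) : MulAut (SurfaceGroup 3)), (z02.toMulEquiv.symm.trans ((T 2).trans z02.toMulEquiv) : MulAut (SurfaceGroup 3))⁆ : MulAut (SurfaceGroup 3)), (⁅((MulEquiv.refl (SurfaceGroup 3)).symm.trans (β.trans (MulEquiv.refl (SurfaceGroup 3))) : MulAut (SurfaceGroup 3)), ((e12.toMulEquiv.symm.trans z01.toMulEquiv).symm.trans ((T 1).trans (e12.toMulEquiv.symm.trans z01.toMulEquiv)) : MulAut (SurfaceGroup 3))⁆ : MulAut (SurfaceGroup 3)), (⁅((MulEquiv.refl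 (SurfaceGroup 3)).symm.trans (β.trans (MulEquiv.refl (SurfaceGroup 3))) : MulAut (SurfaceGroup 3)), ((e12.toMulEquiv.trans z02.toMulEquiv).symm.trans ((T 2).trans (e12.toMulEquiv.trans z02.toMulEquiv)) : MulAut (SurfaceGroup 3))⁆ : MulAut (SurfaceGroup 3)), (⁅(z02.toMulEquiv.symm.symm.trans (β.trans z02.toMulEquiv.symm) : MulAut (SurfaceGroup 3)), (z01.toMulEquiv.symm.trans ((T 1).trans z01.toMulEquiv) : MulAut (SurfaceGroup 3))⁆ : MulAut (SurfaceGroup 3)), (⁅(x4 : MulAut (SurfaceGroup 3)), (e12.toMulEquiv.symm.trans ((T 1).trans e12.toMulEquiv) : MulAut (SurfaceGroup 3))⁆ : MulAut (SurfaceGroup 3)), (⁅(w02.toMulEquiv.symm.trans (β.trans w02.toMulEquiv) : MulAut (SurfaceGroup 3)), (z02.toMulEquiv.symm.trans ((T 2).trans z02.toMulEquiv) : MulAut (SurfaceGroup 3))⁆ : MulAut (SurfaceGroup 3))], fun k => ?_⟩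
  fin_cases k
  · exact ⟨r00, r01, r02, fun j => by fin_cases j <;> [exact r03; exact r04; exact r05]⟩
  · exact ⟨r10, r11, r12, fun j => by fin_cases j <;> [exact r13; exact r14; exact r15]⟩
  · exact ⟨r20, r21, r22, fun j => by fin_cases j <;> [exact r23; exact r24; exact r25]⟩
  · exact ⟨r30, r31, r32, fun j => by fin_cases j <;> [exact r33; exact r34; exact r35]⟩
  · exact ⟨r40, r41, r42, fun j => by fin_cases j <;> [exact r43; exact r44; exact r45]⟩
  · exact ⟨r50, r51, r52, fun j => by fin_cases j <;> [exact r53; exact r54; exact r55]⟩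

end Symbols

end LayerZeroTwo

/-- **Registered helper `helper_layerZeroTwoTransferFour`** (sub-goal of stub `stub_layerStepZeroTwo`, item
stmt-SmoothPoincare4-14595): transfer one level up — an element of `γ₄(S₃)` whose image under a surjection onto `F₃`
without hidden depth lies in `γ₅` lies in `[ker, S₃] γ₅`, in closed form. [folklore] -/
theorem helper_layerZeroTwoTransferFour : ∀ (π : Literature.Topology.FourManifolds.SurfaceGroup 3 →* FreeGroup (Fin 3)), Function.Surjective π → π.ker ⊓ (⊤ : Subgroup (Literature.Topology.FourManifolds.SurfaceGroup 3)).lowerCentralSeries 1 ≤ ⁅π.ker, (⊤ : Subgroup (Literature.Topology.FourManifolds.SurfaceGroup 3))⁆ → ∀ w : Literature.Topology.FourManifolds.SurfaceGroup 3, w ∈ (⊤ : Subgroup (Literature.Topology.FourManifolds.SurfaceGroup 3)).lowerCentralSeries 3 → π w ∈ (⊤ : Subgroup (FreeGroup (Fin 3))).lowerCentralSeries 4 → w ∈ ⁅π.ker, (⊤ : Subgroup (Literature.Topology.FourManifolds.SurfaceGroup 3))⁆ ⊔ (⊤ : Subgroup (Literature.Topology.FourManifolds.SurfaceGroup 3)).lowerCentralSeries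 4 :=
  fun π hπ hker _ hw h => LayerZeroTwo.mem_commutator_sup_of_map_mem₄ π hπ hker hw h

end Summit.SmoothPoincare4.SmoothPoincare4.Theorems.ShadowApproximation.NilpotentGenusClass

end
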